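import Summits.CriticalPhenomena.SAWScalingLimit.Theses.SAWBrickWallHomotopy
import Summits.CriticalPhenomena.SAWScalingLimit.Theses.SAWConfRestriction
import Summits.CriticalPhenomena.SAWScalingLimit.Theorems.SAWBrickWallHomotopyModulusUniversalityAffineTransport
import Summits.CriticalPhenomena.SAWScalingLimit.Theorems.SAWBrickWallHomotopyModulusUniversalityImpliesZ2Tight
import Summits.CriticalPhenomena.SAWScalingLimit.Theorems.SAWBrickWallHomotopyModulusUniversalityLipOfEndpointCoupling
import Summits.CriticalPhenomena.SAWScalingLimit.Theorems.SAWBrickWallHomotopyModulusUniversalityOfLatticeUniversality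
import Summits.CriticalPhenomena.SAWScalingLimit.Theorems.SAWCompassLatticeSurfaceUniversalityTightToll
import Literature.Probability.RandomPlanarGeometry.LatticeSimilarityCovariance
import Literature.Probability.RandomPlanarGeometry.ConformalRestrictionProofs
import Literature.Probability.Percolation.QuadCrossingCrossedEventInterior
import HarnessLib

/-!
# `ModulusUniversality`, line `birth`: the tightness leaf can be taken on the `ℤ²` side (reshape 3)

Helper file (`--supports stmt-CriticalPhenomena-5790`) of the line `birth` / `registered` for the crux
`SAWBrickWallHomotopy.ModulusUniversality` (skeleton
`Summits/CriticalPhenomena/SAWScalingLimit/Cruxes/ModulusUniversality/Lines/birth.lean`, reshape 3).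

The skeleton composes the crux from three open stubs: (A) `BrickWallComparison` (= the route crux
`BrickWallFlow`, stmt-CriticalPhenomena-5791, at `t = 0`), a TIGHTNESS leaf, and (L) `JitteredLipMerging`
(bounded-Lipschitz merging of the straight and the jittered critical brick-wall laws).  Up to reshape 2 the
tightness leaf was hexagonal (`SAWDevelopingMap.HexTight`, stmt-5423).  This file proves that it can be
taken to be the `ℤ²`-side item `SAWConfRestriction.EventualTight` (stmt-CriticalPhenomena-1881) instead,
which the crux is already known to IMPLY (`z2Tight_of_modulusUniversality`, file `…ImpliesZ2Tight.lean`):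

* `tendsto_sub_jittered_of_tight` — the analytic core.  For a modulus map `Ψ`, a Dobrushin `D` with `ℤ²`
  endpoint approximation `(a,b)`, a `ℤ²` approximation `(a₁,b₁)` of `Ψ⁻¹D` with eventually genuine straight
  brick-wall law and a jittered approximation `(a',b')` of `Ψ⁻¹D`: tightness of the `ℤ²` curve laws of
  `(D,a,b)` + `C_b`-merging of the `ℤ²` law with the `Ψ`-image of the straight law + bounded-Lipschitz
  merging of the straight and jittered laws ⇒ `C_b`-merging of the `ℤ²` law with the `Ψ`-image of the
  jittered law.  Proof: the tree's one-sided Prokhorov upgrade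
  `SurfaceUniversality.tendsto_sub_of_isTightAlongMesh` for the TIGHT random curve classes
  `CurveClass.map Ψ⁻¹ ∘ curve` under the `ℤ²` law (`isTightAlongMesh_map`) against the jittered law pushed to
  curves; their Lipschitz merging is [A on `g ∘ map Ψ⁻¹`] + [L on `g`]; then test on `f ∘ map Ψ`
  (`curveClass_map_symm_map`, `curveClass_map_map_symm`).
* `modulusUniversality_of_eventualTight` — the reshape-3 composition with the three stubs as displayed
  hypotheses: `(A, literal) → SAWConfRestriction.EventualTight → (L, literal) → ModulusUniversality`
  (`Φ = Ψ ∘ B`, the landed affine transport `stub_affineTransport`, `MarkedDomain.map_map`,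
  `CurveClass.map_homeomorph_trans`).
* the converse edge on the tightness leaf is the landed `z2Tight_of_modulusUniversality` (its conclusion is
  `SAWConfRestriction.EventualTight` unfolded): the reshape-3 tightness stub is NECESSARY as well as sufficient.

So, kernel-checked: `ModulusUniversality ⇐ BrickWallFlow(t=0) ∧ EventualTight(1881) ∧ JitteredLipMerging`
and `ModulusUniversality ⇒ EventualTight(1881)`.  All bookkeeping tagged [folklore].
-/

noncomputable section

open MeasureTheory Filter Topology
open scoped NNReal ENNReal
open Literature.Probability.LatticeModels
open Literature.Probability.RandomPlanarGeometry

namespace Summit.CriticalPhenomena.SAWScalingLimit.Cruxes.ModulusUniversality.Birth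

/-! ### Small curve-space lemmas -/

/-- `CurveClass.map Ψ⁻¹ (CurveClass.map Ψ c) = c` for a plane homeomorphism `Ψ`. [folklore] -/
theorem curveClass_map_symm_map (Ψ : ℂ ≃ₜ ℂ) (c : CurveClass ℂ) :
    CurveClass.map (Ψ.symm : C(ℂ, ℂ)) (CurveClass.map (Ψ : C(ℂ, ℂ)) c) = c := by
  have h := congrFun (CurveClass.map_homeomorph_trans Ψ Ψ.symm) c
  rw [Homeomorph.self_trans_symm, Function.comp_apply, curveClass_map_refl] at h
  exact h.symm

/-- `CurveClass.map Ψ (CurveClass.map Ψ⁻¹ c) = c` for a plane homeomorphism `Ψ`. [folklore] -/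
theorem curveClass_map_map_symm (Ψ : ℂ ≃ₜ ℂ) (c : CurveClass ℂ) :
    CurveClass.map (Ψ : C(ℂ, ℂ)) (CurveClass.map (Ψ.symm : C(ℂ, ℂ)) c) = c := by
  have h := congrFun (CurveClass.map_homeomorph_trans Ψ.symm Ψ) c
  rw [Homeomorph.symm_trans_self, Function.comp_apply, curveClass_map_refl] at h
  exact h.symm

/-- Tightness along the mesh is preserved by continuous images: if the random curve classes `Y δ` are tight
under `P δ`, so are `CurveClass.map φ ∘ Y δ` (continuous images of compact sets are compact). [folklore] -/
theorem isTightAlongMesh_map {Ωδ : ℝ → Type*} [∀ δ, MeasurableSpace (Ωδ δ)]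
    {Y : ∀ δ, Ωδ δ → CurveClass ℂ} {P : ∀ δ, Measure (Ωδ δ)} (h : IsTightAlongMesh Y P)
    (φ : C(ℂ, ℂ)) : IsTightAlongMesh (fun δ ω => CurveClass.map φ (Y δ ω)) P := by
  intro ε hε
  obtain ⟨K, hK, hev⟩ := h ε hε
  refine ⟨CurveClass.map φ '' K, hK.image (CurveClass.continuous_map φ), ?_⟩
  filter_upwards [hev] with δ hδ
  refine le_trans (measure_mono ?_) hδ
  intro ω hω
  simp only [Set.mem_preimage, Set.mem_compl_iff] at hω ⊢
  exact fun hK' => hω ⟨_, hK', rfl⟩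

/-- From Lipschitz merging with the constant test function `1`: if `P δ` is eventually a probability measure,
so is the generic SAW law `embLaw` it merges with (the junk value `0` is excluded, `embLaw_zero_or_prob`).
[folklore] -/
theorem eventually_isProbabilityMeasure_embLaw_of_merging {V : Type*} {G : SimpleGraph V}
    {emb : V → ℂ} {Ω : Set ℂ} {x : ℝ} {a' b' : ℝ → V} {α : ℝ → Type*}
    [∀ δ, MeasurableSpace (α δ)] {P : ∀ δ, Measure (α δ)}
    (hP : ∀ᶠ δ in nhdsWithin 0 (Set.Ioi 0), IsProbabilityMeasure (P δ))
    (h1 : Tendsto (fun δ => (∫ _ω, (1 : ℝ) ∂(P δ)) -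
      ∫ _γ, (1 : ℝ) ∂(SAW.embLaw G emb Ω δ x (a' δ) (b' δ))) (nhdsWithin 0 (Set.Ioi 0)) (nhds 0)) :
    ∀ᶠ δ in nhdsWithin 0 (Set.Ioi 0), IsProbabilityMeasure (SAW.embLaw G emb Ω δ x (a' δ) (b' δ)) := by
  have hev : ∀ᶠ δ in nhdsWithin 0 (Set.Ioi 0), dist ((∫ _ω, (1 : ℝ) ∂(P δ)) -
      ∫ _γ, (1 : ℝ) ∂(SAW.embLaw G emb Ω δ x (a' δ) (b' δ))) 0 < 1 / 2 :=
    Metric.tendsto_nhds.1 h1 _ one_half_pos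
  filter_upwards [hP, hev] with δ hPδ hδ
  rcases embLaw_zero_or_prob G emb Ω δ x (a' δ) (b' δ) with h | h
  · exfalso
    rw [h] at hδ
    simp at hδ
    norm_num at hδ
  · exact h

/-! ### The analytic core: tightness on the `ℤ²` side upgrades Lipschitz merging of the two conventions -/

/-- **Two-convention upgrade.**  Fix the modulus map `Ψ`, the affinity `B`, a Dobrushin `D` with a `ℤ²` endpoint
approximation `(a, b)`, a `ℤ²` endpoint approximation `(a₁, b₁)` of `E = Ψ⁻¹D` carrying an eventually genuine
straight brick-wall law, and a jittered endpoint approximation `(a', b')` of `E`.  IF the `ℤ²` curve laws of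
`(D, a, b)` are tight along the mesh, the `ℤ²` law merges with the `Ψ`-image of the straight law on all bounded
continuous `f`, and the straight and jittered laws merge on bounded Lipschitz `g`, THEN the `ℤ²` law merges
with the `Ψ`-image of the JITTERED law on all bounded continuous `f`.  Proof: one-sided Prokhorov upgrade
`tendsto_sub_of_isTightAlongMesh` for the tight random curve classes `CurveClass.map Ψ⁻¹ ∘ curve` under the
`ℤ²` law against the jittered law pushed to curves; their Lipschitz merging is [A tested on `g ∘ map Ψ⁻¹`] +
[L]; then test on `f ∘ map Ψ`. [folklore] -/
theorem tendsto_sub_jittered_of_tight {Ψ B : ℂ ≃ₜ ℂ} {D : DobrushinDomain} {a b a₁ b₁ : ℝ → Site 2}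
    {a' b' : ℝ → HexVertex} (hab : SAW.IsEndpointApprox D a b)
    (hZ : IsTightAlongMesh (fun δ (γ : SAW.DomainSAW D.carrier δ (a δ) (b δ)) => γ.curve)
      (fun δ => SAW.law D.carrier δ (a δ) (b δ)))
    (hprob : ∀ᶠ δ in nhdsWithin 0 (Set.Ioi 0),
      IsProbabilityMeasure (SAW.brickWallLaw (D.map Ψ.symm).carrier δ 0 (a₁ δ) (b₁ δ)))
    (hA : ∀ f : BoundedContinuousFunction (CurveClass ℂ) ℝ,
      Tendsto (fun δ => (∫ γ, f γ.curve ∂(SAW.law D.carrier δ (a δ) (b δ))) -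
        ∫ γ, f (CurveClass.map (Ψ : C(ℂ, ℂ)) γ.curve)
          ∂(SAW.brickWallLaw (D.map Ψ.symm).carrier δ 0 (a₁ δ) (b₁ δ)))
        (nhdsWithin 0 (Set.Ioi 0)) (nhds 0))
    (hL : ∀ (g : BoundedContinuousFunction (CurveClass ℂ) ℝ) (L : NNReal), LipschitzWith L g →
      Tendsto (fun δ => (∫ γ, g γ.curve ∂(SAW.brickWallLaw (D.map Ψ.symm).carrier δ 0 (a₁ δ) (b₁ δ))) -
        ∫ γ, g γ.curve ∂(SAW.embLaw hexGraph (fun v : HexVertex => B (hexCenter v)) (D.map Ψ.symm).carrier δ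
          SAW.hexCriticalFugacity (a' δ) (b' δ)))
        (nhdsWithin 0 (Set.Ioi 0)) (nhds 0))
    (f : BoundedContinuousFunction (CurveClass ℂ) ℝ) :
    Tendsto (fun δ => (∫ γ, f γ.curve ∂(SAW.law D.carrier δ (a δ) (b δ))) -
        ∫ γ, f (CurveClass.map (Ψ : C(ℂ, ℂ)) γ.curve)
          ∂(SAW.embLaw hexGraph (fun v : HexVertex => B (hexCenter v)) (D.map Ψ.symm).carrier δ
            SAW.hexCriticalFugacity (a' δ) (b' δ)))
      (nhdsWithin 0 (Set.Ioi 0)) (nhds 0) := by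
  -- the jittered law is eventually a probability measure (L at `g ≡ 1`)
  have h1 := hL (BoundedContinuousFunction.const (CurveClass ℂ) (1 : ℝ)) 0 (fun x y => by simp)
  have hJprob : ∀ᶠ δ in nhdsWithin 0 (Set.Ioi 0), IsProbabilityMeasure
      (SAW.embLaw hexGraph (fun v : HexVertex => B (hexCenter v)) (D.map Ψ.symm).carrier δ
        SAW.hexCriticalFugacity (a' δ) (b' δ)) :=
    eventually_isProbabilityMeasure_embLaw_of_merging hprob (by simpa using h1)
  have hmapJ : ∀ (δ : ℝ) (g : BoundedContinuousFunction (CurveClass ℂ) ℝ),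
      ∫ x, g x ∂((SAW.embLaw hexGraph (fun v : HexVertex => B (hexCenter v)) (D.map Ψ.symm).carrier δ
        SAW.hexCriticalFugacity (a' δ) (b' δ)).map (fun γ => γ.curve)) =
      ∫ γ, g γ.curve ∂(SAW.embLaw hexGraph (fun v : HexVertex => B (hexCenter v)) (D.map Ψ.symm).carrier δ
        SAW.hexCriticalFugacity (a' δ) (b' δ)) := fun δ g =>
    integral_map (SAW.EmbDomainSAW.measurable_of_top _).aemeasurable
      g.continuous.aestronglyMeasurable
  -- the one-sided Prokhorov upgrade, tight side = `map Ψ⁻¹ ∘ curve` under the ℤ² law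
  have key := Summit.CriticalPhenomena.SAWScalingLimit.Theorems.SurfaceUniversality.tendsto_sub_of_isTightAlongMesh
    (Ω := fun δ => SAW.DomainSAW D.carrier δ (a δ) (b δ))
    (Y := fun δ (γ : SAW.DomainSAW D.carrier δ (a δ) (b δ)) =>
      CurveClass.map (Ψ.symm : C(ℂ, ℂ)) γ.curve)
    (P := fun δ => SAW.law D.carrier δ (a δ) (b δ))
    (ν := fun δ => (SAW.embLaw hexGraph (fun v : HexVertex => B (hexCenter v)) (D.map Ψ.symm).carrier δ
        SAW.hexCriticalFugacity (a' δ) (b' δ)).map (fun γ => γ.curve))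
    (Summit.CriticalPhenomena.SAWScalingLimit.Theorems.SubseqIdentification.Negative.eventually_isProbabilityMeasure_law
      hab)
    (Eventually.of_forall fun δ => (SAW.DomainSAW.measurable_of_top _).aemeasurable)
    (isTightAlongMesh_map hZ (Ψ.symm : C(ℂ, ℂ)))
    (by
      filter_upwards [hJprob] with δ hδ
      exact Measure.isProbabilityMeasure_map (SAW.EmbDomainSAW.measurable_of_top _).aemeasurable)
    (by
      intro g L hg
      -- [A on `g ∘ map Ψ⁻¹`] + [L on `g`]
      set G : BoundedContinuousFunction (CurveClass ℂ) ℝ :=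
        g.compContinuous ⟨CurveClass.map (Ψ.symm : C(ℂ, ℂ)), CurveClass.continuous_map _⟩ with hG
      have hGΨ : ∀ c : CurveClass ℂ, G (CurveClass.map (Ψ : C(ℂ, ℂ)) c) = g c := fun c => by
        simp only [hG, BoundedContinuousFunction.compContinuous_apply, ContinuousMap.coe_mk,
          curveClass_map_symm_map]
      have hGid : ∀ c : CurveClass ℂ, G c = g (CurveClass.map (Ψ.symm : C(ℂ, ℂ)) c) := fun c => by
        simp only [hG, BoundedContinuousFunction.compContinuous_apply, ContinuousMap.coe_mk]
      have hsum := (hA G).add (hL g L hg)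
      rw [add_zero] at hsum
      refine hsum.congr fun δ => ?_
      rw [hmapJ]
      simp only [hGΨ, hGid]
      ring)
    (f.compContinuous ⟨CurveClass.map (Ψ : C(ℂ, ℂ)), CurveClass.continuous_map _⟩)
  refine key.congr fun δ => ?_
  rw [hmapJ]
  simp only [BoundedContinuousFunction.compContinuous_apply, ContinuousMap.coe_mk, curveClass_map_map_symm]

/-! ### The reshape-3 composition -/

/-- **Reshape-3 composition: (A) `BrickWallComparison` → `SAWConfRestriction.EventualTight` (stmt-1881) →
(L) `JitteredLipMerging` → `ModulusUniversality`**, the stubs displayed literally.  Glue: `r₁ = 2ρ₁`,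
`r₂ = (2/√3)ρ₂`, `Φ = diag(r₁, r₂) = Ψ ∘ B` with `Ψ = diag(ρ₁, ρ₂)`, `B = diag(2, 2/√3)`
(`QuadCrossing.stretchHomeomorph`; `Homeomorph.ext`); (A) at `(D,a,b)` gives `(a₁,b₁)` in `E = Ψ⁻¹D`; (L) at
`(E,a₁,b₁)` gives the jittered `(a',b')`; the landed affine transport `stub_affineTransport` makes it a hexagonal
endpoint approximation of `B⁻¹E = Φ⁻¹D` (`MarkedDomain.map_map`) and identifies the jittered curve integrals with
hexagonal ones composed with `CurveClass.map B`; `tendsto_sub_jittered_of_tight` (tightness from stmt-1881 at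
`(D,a,b)`) gives the merging of the `ℤ²` law with the `Ψ`-image of the jittered law, i.e. (by
`CurveClass.map_homeomorph_trans`) with the `Φ`-image of the hexagonal law. [folklore] -/
theorem modulusUniversality_of_eventualTight : (∃ ρ₁ ρ₂ : ℝ, 0 < ρ₁ ∧ 0 < ρ₂ ∧ ∀ Ψ : ℂ ≃ₜ ℂ, (∀ z : ℂ, Ψ z = ((ρ₁ * z.re : ℝ) : ℂ) + ((ρ₂ * z.im : ℝ) : ℂ) * Complex.I) → ∀ (D : DobrushinDomain) (a b : ℝ → Site 2), SAW.IsEndpointApprox D a b → ∃ a' b' : ℝ → Site 2, SAW.IsEndpointApprox (D.map Ψ.symm) a' b' ∧ (∀ᶠ δ in nhdsWithin 0 (Set.Ioi 0), IsProbabilityMeasure (SAW.brickWallLaw (D.map Ψ.symm).carrier δ 0 (a' δ) (b' δ))) ∧ ∀ f : BoundedContinuousFunction (CurveClass ℂ) ℝ, Tendsto (fun δ => (∫ γ, f γ.curve ∂(SAW.law D.carrier δ (a δ) (b δ))) - ∫ γ, f (CurveClass.map (Ψ : C(ℂ, ℂ)) γ.curve) ∂(SAW.brickWallLaw (D.map Ψ.symm).carrier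 δ 0 (a' δ) (b' δ))) (nhdsWithin 0 (Set.Ioi 0)) (nhds 0)) → Summit.CriticalPhenomena.SAWScalingLimit.Theses.SAWConfRestriction.EventualTight → (∀ B : ℂ ≃ₜ ℂ, (∀ z : ℂ, B z = ((2 * z.re : ℝ) : ℂ) + ((2 / Real.sqrt 3 * z.im : ℝ) : ℂ) * Complex.I) → ∀ (E : DobrushinDomain) (a b : ℝ → Site 2), SAW.IsEndpointApprox E a b → (∀ᶠ δ in nhdsWithin 0 (Set.Ioi 0), IsProbabilityMeasure (SAW.brickWallLaw E.carrier δ 0 (a δ) (b δ))) → ∃ a' b' : ℝ → HexVertex, SAW.IsEmbEndpointApprox hexGraph (fun v : HexVertex => B (hexCenter v)) E a' b' ∧ ∀ (g : BoundedContinuousFunction (CurveClass ℂ) ℝ) (L : NNReal), LipschitzWith L g → Tendsto (fun δ => (∫ γ, g γ.curve ∂(SAW.brickWallLaw E.carrier δ 0 (a δ) (b δ))) - ∫ γ, g γ.curve ∂(SAW.embLaw hexGraph (fun v : HexVertex => B (hexCenter v)) E.carrier δ SAW.hexCriticalFugacity (a' δ) (b' δ))) (nhdsWithin 0 (Set.Ioi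 0)) (nhds 0)) → Summit.CriticalPhenomena.SAWScalingLimit.Theses.SAWBrickWallHomotopy.ModulusUniversality := by
  intro hA hZ hL
  obtain ⟨ρ₁, ρ₂, hρ₁, hρ₂, hA⟩ := hA
  have h3 : 0 < Real.sqrt 3 := Real.sqrt_pos.2 (by norm_num)
  have h23 : (0 : ℝ) < 2 / Real.sqrt 3 := div_pos two_pos h3
  -- the affinity `B = diag(2, 2/√3)` (embedded honeycomb → brick wall) and the modulus map `Ψ = diag(ρ₁, ρ₂)`
  obtain ⟨B, hBz⟩ : ∃ B : ℂ ≃ₜ ℂ,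
      ∀ z : ℂ, B z = ((2 * z.re : ℝ) : ℂ) + ((2 / Real.sqrt 3 * z.im : ℝ) : ℂ) * Complex.I :=
    ⟨Literature.Probability.Percolation.QuadCrossing.stretchHomeomorph 2 (2 / Real.sqrt 3) two_pos h23,
      fun z => by
        rw [Literature.Probability.Percolation.QuadCrossing.stretchHomeomorph_apply, Complex.mk_eq_add_mul_I]⟩
  obtain ⟨Ψ, hΨz⟩ : ∃ Ψ : ℂ ≃ₜ ℂ,
      ∀ z : ℂ, Ψ z = ((ρ₁ * z.re : ℝ) : ℂ) + ((ρ₂ * z.im : ℝ) : ℂ) * Complex.I :=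
    ⟨Literature.Probability.Percolation.QuadCrossing.stretchHomeomorph ρ₁ ρ₂ hρ₁ hρ₂, fun z => by
      rw [Literature.Probability.Percolation.QuadCrossing.stretchHomeomorph_apply, Complex.mk_eq_add_mul_I]⟩
  refine ⟨2 * ρ₁, 2 / Real.sqrt 3 * ρ₂, mul_pos two_pos hρ₁, mul_pos h23 hρ₂, ?_⟩
  intro Φ hΦ D a b hab
  -- `Φ = Ψ ∘ B`
  have hΦeq : Φ = B.trans Ψ := by
    refine Homeomorph.ext fun z => ?_
    rw [Homeomorph.trans_apply, hΦ, hΨz, hBz]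
    apply Complex.ext
    · simp only [Complex.add_re, Complex.add_im, Complex.mul_re, Complex.mul_im, Complex.ofReal_re,
        Complex.ofReal_im, Complex.I_re, Complex.I_im]
      ring
    · simp only [Complex.add_re, Complex.add_im, Complex.mul_re, Complex.mul_im, Complex.ofReal_re,
        Complex.ofReal_im, Complex.I_re, Complex.I_im]
      ring
  subst hΦeq
  -- (A): ℤ² law in `D` ≈ `Ψ`-image of the straight brick-wall law in `E = Ψ⁻¹ D`
  obtain ⟨a₁, b₁, hab₁, hprob, hT₁⟩ := hA Ψ hΨz D a b hab
  -- (L): straight brick-wall law in `E` ≈ jittered brick-wall law in `E` on bounded Lipschitz functions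
  obtain ⟨a', b', habj, hT₂⟩ := hL B hBz (D.map Ψ.symm) a₁ b₁ hab₁ hprob
  -- (T): jittered brick-wall law in `E` = `B`-image of the hexagonal law in `B⁻¹ E`, exactly
  obtain ⟨hab', hEq⟩ := stub_affineTransport B hBz (D.map Ψ.symm) a' b' habj
  rw [MarkedDomain.map_map] at hab' hEq
  have hs : (B.trans Ψ).symm = Ψ.symm.trans B.symm := rfl
  rw [hs]
  refine ⟨a', b', hab', fun f => ?_⟩
  have hEq' : ∀ δ : ℝ,
      (∫ γ, f (CurveClass.map (Ψ : C(ℂ, ℂ)) γ.curve)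
        ∂(SAW.embLaw hexGraph (fun v : HexVertex => B (hexCenter v)) (D.map Ψ.symm).carrier δ
          SAW.hexCriticalFugacity (a' δ) (b' δ))) =
      ∫ γ, f (CurveClass.map ((B.trans Ψ : ℂ ≃ₜ ℂ) : C(ℂ, ℂ)) γ.curve)
        ∂(SAW.hexSAWLaw (D.map (Ψ.symm.trans B.symm)).carrier δ (a' δ) (b' δ)) := fun δ => by
    have h := hEq δ (f.compContinuous ⟨CurveClass.map (Ψ : C(ℂ, ℂ)), CurveClass.continuous_map _⟩)
    simp only [BoundedContinuousFunction.compContinuous_apply, ContinuousMap.coe_mk] at h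
    rw [h]
    simp only [CurveClass.map_homeomorph_trans, Function.comp_apply]
  -- tightness (stmt-1881) at `(D, a, b)` + the two-convention upgrade
  have key := tendsto_sub_jittered_of_tight (B := B) hab (hZ D a b hab) hprob hT₁ hT₂ f
  refine key.congr fun δ => ?_
  rw [hEq']

end Summit.CriticalPhenomena.SAWScalingLimit.Cruxes.ModulusUniversality.Birth

end
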